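import Summits.BirchSwinnertonDyer.BirchSwinnertonDyer.Theorems.ClassRecordThreeEulerHalvesAtThreeCartanTorusCubeCutPSCube
import Summits.BirchSwinnertonDyer.BirchSwinnertonDyer.Theorems.ClassRecordThreeEulerHalvesAtThreeCartanTorusCubeCutPSModThree
import HarnessLib

/-!
# Crux 23422 line `cartan` v9, stub (F2a), PRINCIPAL-SERIES half of the torus-cube cut — file PS-7 (helper): the `U`-norm image is NOT
# CYCLIC MOD 3 — `rk_{𝔽₃} red(N_U X) ≡ 2 (mod 3)`, so for every `x₀` some `N_U y ∉ ℤx₀ + 3X` (lattice half of «`X^U ⊄ X_M`»)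

Seat `bsd-stepL-cartan-f2a` g0 (explicit unit, pen g44 AUTOFILL #2 row (3′); `--supports stmt-BirchSwinnertonDyer-23422 --as helper`).
For `q ≡ 1 (mod 3)` the reduced unipotent norm `Ē = redEnd(N_U)` on `X̄ = 𝔽₃^d` is an idempotent (`N_U² = q N_U`, `q = 1` in `𝔽₃`) of trace
`tr N_U = 2q = 2`; by Mathlib's `LinearMap.IsProj.trace` its range has `𝔽₃`-dimension `≡ 2 (mod 3)`, in particular is not contained in a
line. RESULT `exists_normU_not_mem_line`: for every `x₀ ∈ X` some `y` has `N_U y ≠ c·x₀ + 3z` for all `c ∈ ℤ`, `z ∈ X`. With the line owner's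
`K^U = 𝔽₃·x̄₀` (Steinberg side) this yields a `U`-fixed `u₀ = N_U y ∉ X_M`, the vector of hypothesis `hcube` of `psNonsplitNormSharp_of_line`.
HONEST FRAMING: linear algebra mod 3 on one lattice; S-K1′ is NOT proved, no summit statement, no route item and no registered stub is
proved; BSD is proved for no curve. [folklore]
-/

namespace Summit.BirchSwinnertonDyer.BirchSwinnertonDyer.Theorems.CartanTorusCubeCut.PS

open Summit.BirchSwinnertonDyer.BirchSwinnertonDyer.Theorems.CartanDegree
open Summit.BirchSwinnertonDyer.BirchSwinnertonDyer.Theorems.CartanTorusCubeCut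

set_option linter.dupNamespace false
set_option autoImplicit false

section Rank
variable {q : ℕ} [Fact q.Prime]
variable (u : ZMod q → G q) (hu : ∀ y, ((u y : G q) : Mat q) = !![1, y; 0, 1])
variable (𝓛 : CartanTorusLattice q)
include hu

/-- `Ē = redEnd(N_U)` is an idempotent of `X̄` when `q ≡ 1 (mod 3)`. -/
theorem redEnd_normU_idem (h1 : q % 3 = 1) :
    IsIdempotentElem (redEnd 𝓛.d (∑ y : ZMod q, 𝓛.ρ (u y))) := by
  change redEnd 𝓛.d (∑ y : ZMod q, 𝓛.ρ (u y)) * redEnd 𝓛.d (∑ y : ZMod q, 𝓛.ρ (u y)) = _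
  rw [← redEnd_mul, normU_mul_self u hu 𝓛, redEnd_zsmul]
  have hq : ((q : ℤ) : ZMod 3) = 1 := by
    rw [Int.cast_natCast]
    have : (q : ZMod 3) = ((q % 3 : ℕ) : ZMod 3) := by rw [ZMod.natCast_mod]
    rw [this, h1, Nat.cast_one]
  rw [hq, one_smul]

/-- `tr Ē = 2`. -/
theorem trace_redEnd_normU (h1 : q % 3 = 1) :
    LinearMap.trace (ZMod 3) _ (redEnd 𝓛.d (∑ y : ZMod q, 𝓛.ρ (u y))) = 2 := by
  rw [trace_redEnd, trace_normU u hu 𝓛 h1]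
  push_cast
  have : (q : ZMod 3) = ((q % 3 : ℕ) : ZMod 3) := by rw [ZMod.natCast_mod]
  rw [this, h1, Nat.cast_one, mul_one]

/-- **the range of `Ē` is not contained in a line** (its dimension is `≡ 2 (mod 3)`). -/
theorem range_redEnd_normU_not_le_span (h1 : q % 3 = 1) (x : Fin 𝓛.d → ZMod 3) :
    ¬ LinearMap.range (redEnd 𝓛.d (∑ y : ZMod q, 𝓛.ρ (u y))) ≤ (ZMod 3) ∙ x := by
  intro hle
  set E := redEnd 𝓛.d (∑ y : ZMod q, 𝓛.ρ (u y)) with hE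
  have hproj := LinearMap.IsIdempotentElem.isProj_range E (redEnd_normU_idem u hu 𝓛 h1)
  have htr := hproj.trace
  rw [hE, trace_redEnd_normU u hu 𝓛 h1] at htr
  have hspan : Module.finrank (ZMod 3) ((ZMod 3) ∙ x) ≤ 1 := by
    by_cases hx : x = 0
    · rw [hx, Submodule.span_zero_singleton, finrank_bot]; exact Nat.zero_le 1
    · rw [finrank_span_singleton hx]
  have hfin : Module.finrank (ZMod 3) (LinearMap.range E) ≤ 1 := (Submodule.finrank_mono hle).trans hspan
  -- `finrank ∈ {0, 1}` contradicts `(finrank : 𝔽₃) = 2`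
  interval_cases h : Module.finrank (ZMod 3) (LinearMap.range E)
  · exact absurd htr (by decide)
  · exact absurd htr (by decide)

/-- **`N_U X ⊄ ℤx₀ + 3X` for every `x₀`**: some unipotent norm `N_U y` is not congruent to a multiple of `x₀` modulo `3X`. -/
theorem exists_normU_not_mem_line (h1 : q % 3 = 1) (x₀ : Fin 𝓛.d → ℤ) :
    ∃ y : Fin 𝓛.d → ℤ, ∀ (c : ℤ) (z : Fin 𝓛.d → ℤ), (∑ t : ZMod q, 𝓛.ρ (u t)) y ≠ c • x₀ + (3 : ℤ) • z := by
  by_contra hall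
  push Not at hall
  apply range_redEnd_normU_not_le_span u hu 𝓛 h1 (red 𝓛.d x₀)
  rintro w ⟨v, rfl⟩
  obtain ⟨y, rfl⟩ := red_surjective 𝓛.d v
  obtain ⟨c, z, hcz⟩ := hall y
  rw [redEnd_red, hcz, map_add, map_zsmul, (red_eq_zero_iff 𝓛.d _).2 ⟨z, rfl⟩, add_zero]
  exact zsmul_mem (Submodule.mem_span_singleton_self _) c

end Rank

end Summit.BirchSwinnertonDyer.BirchSwinnertonDyer.Theorems.CartanTorusCubeCut.PS
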